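import Summits.AtomisticToContinuum.Crystallization.Theorems.FrustratedLawDichotomyStrainedPatchHomEntryLeafHTA2QCellG80XV2

/-!
# v3 ANCHOR CELL (T0) `cT080 × wG80X` (0.80 t_b, SIX-coarse: 2⁻¹⁰ on (0,0),(1,1),(0,1), 2⁻⁹ else (k₆ = 3½)), part 3: far sum, ONE inner leaf, END TO END in the v3 currency
# (27623 `(H) HomFloor (1/625)`, hcp half; pre-staged by hand-1 g37, LANDED by hand-1 g38 on critic GO row 1436 (E) / 1437 (E) «T0 anchors»)

Kernel facts + assembly; 0 sorry; standard axioms.  `--supports stmt-AtomisticToContinuum-27623`.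
-/

namespace Summit.AtomisticToContinuum.Crystallization.Theorems.FrustratedLawDichotomyStrainedPatchHomEntryLeafHT

open Literature.Analysis.ValidatedNumerics.Numerics
open Summit.AtomisticToContinuum.Crystallization.Theorems.FrustratedLawDichotomyStrainedPatchHomCertTree (CertTree treeOK)
open Summit.AtomisticToContinuum.Crystallization.Theorems.FrustratedLawDichotomyStrainedPatchHomEntryTable (muRec)
open Summit.AtomisticToContinuum.Crystallization.Theorems.FrustratedLawDichotomyStrainedPatchHomEntryFitHcpCentred (entryLeafOKHQDCRS)
open Summit.AtomisticToContinuum.Crystallization.Theorems.FrustratedLawDichotomyStrainedPatchHomSlopeLJ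
open Summit.AtomisticToContinuum.Crystallization.Theorems.FrustratedLawDichotomyStrainedPatchHomSlopeLJAffine
open Summit.AtomisticToContinuum.Crystallization.Theorems.FrustratedLawDichotomyStrainedPatchHomSlopeLJAffine2Kit
open Summit.AtomisticToContinuum.Crystallization.Theorems.FrustratedLawDichotomyStrainedPatchHomSlopeLJAffine2KitS (rem3LJS)
open Summit.AtomisticToContinuum.Crystallization.Theorems.FrustratedLawDichotomyStrainedPatchHomEntryFitTolerance (cT080)

set_option maxRecDepth 100000 in
set_option maxHeartbeats 4000000 in
/-- ★ KERNEL: `GnG80XV + far₁ + far₂ ≤ pG80XV.Gs`. -/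
theorem farG80XV : GnG80XV + htGsNA cT080 wG80X JG80X (htFar1U cT080 wG80X) + htGsNA cT080 wG80X JG80X (htFar2U cT080 wG80X) ≤ pG80XV.Gs := by
  decide +kernel

/-- ★★★ The sharp-remainder certificate side of the cell holds. [assembly] -/
theorem htCertSideA2QS_G80XV : htCertSideA2QS pG80XV QG80X GnG80XV JG80X cT080 wG80X = true :=
  htCertSideA2QS_of_parts restG80XV qG80X_0 qG80X_1 qG80X_2 linG80XV farG80XV

set_option maxRecDepth 100000 in
set_option maxHeartbeats 4000000 in
/-- ★ KERNEL: ONE inner hull leaf of the squared-test inner verdict closes the confined box `htWr pG80XV`. -/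
theorem treeA2QS_G80XV : treeOK (hullInner (entryLeafOKHQDCRS muRec qX90c) JG80X cT080) CertTree.leaf cT080 (htWr pG80XV cT080 wG80X) = true := by
  decide +kernel

/-- ★★★ **THE CELL CLOSES END TO END IN THE v3 CURRENCY** (one inner leaf). [assembly] -/
theorem entryLeafOKHT4A2QSQDCRS_G80XV : entryLeafOKHT4A2QSQDCRS muRec qX90c pG80XV QG80X GnG80XV JG80X CertTree.leaf cT080 wG80X = true :=
  entryLeafOKHT4A2QSQDCRS_of_parts htCertSideA2QS_G80XV treeA2QS_G80XV

/-- ★ … hence the cell is a one-leaf ∃-tree of the production verdict v3 `entryLeafOKHT4A2QQDCRS3 muRec`. [formal bookkeeping] -/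
theorem okS3_G80X : ∃ t : CertTree ((Fin 3 × Fin 3) ⊕ Fin 3), treeOK (entryLeafOKHT4A2QQDCRS3 muRec) t cT080 wG80X = true :=
  exists_tree_HT4A2QQDCRS3_of_certS3 entryLeafOKHT4A2QSQDCRS_G80XV

end Summit.AtomisticToContinuum.Crystallization.Theorems.FrustratedLawDichotomyStrainedPatchHomEntryLeafHT
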